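import Summits.HodgeConjecture.HodgeConjecture.Theorems.F0P3cStCharTSHtauOnCoset        -- ★ p849908 (LH6-p03): `boxXH_mem_nhds_one` (the box of `T₂ × U(Φ₁)_v` is a nbhd of `1`); brings ★ LEVEL-PICK p849741
import Summits.HodgeConjecture.HodgeConjecture.Theorems.F0P3cStCharTSTorusLevelBasis    -- ★ T-BASIS: `exists_preimage_K_subset_of_mem_nhds` (the levels `T ∩ 𝓘.K n` are a basis of `𝓝 1` in `T`)
import Literature.NumberTheory.Automorphic.CMPrincipalSeriesJacquetEvalOne              -- ★ `nonarchimedeanGroup_cmLocal` (`U(Φ_N)(L⁺_v)` is non-archimedean)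
import Literature.NumberTheory.Automorphic.LocalUnitaryIntegralLevel                    -- ★ `isCompact_isOpen_cmLocalIntegralLevel` (`U(Φ_N)(𝒪_v)` compact open)
import Literature.NumberTheory.Rogawski1990.EndoscopicEmbedding                         -- ★ `endoEmbLocal`, `continuous_endoEmbLocal`
import HarnessLib

/-!
# F0 · P3c · line LH6 «StCharTS» — road (D) «DEEP-FL», brick «LEVEL-PICK-INST★»: the head's choice of the `H`-level — a level `n′` of the `U(Φ₂)`-datum and a compact open
# `K₁ ≤ U(Φ₁)(L⁺_v)` such that every `k = (t, u) ∈ T₂ × U(Φ₁)_v` with `t ∈ K′_{n′}`, `u ∈ K₁` lies in the level-`nμ` BOX (the antecedent of ★ HTAU-ON-COSET p849908) and is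
# PICKED into the `G`-level: `ι_v(t, u) ∈ 𝓘.K n`

Cell `pub/hodgecm-mathlib`, crux H413 = `stmt-HodgeConjecture-24833` (lane `--supports … --as helper`), route HCCMUnconditional; seat LH4-p02 (g3) on the road (D) owner LH6-p04 (g3)'s deal
«LEVEL-PICK-INST★» (2026-09-02).  THEOREMS ONLY: no `def`, no instance, no notation, no `sorry`, no named fact.  HONEST LABEL: HC_CM is proved only modulo the 7 printed citations
(2 remaining: hLiu418 = stmt-HodgeConjecture-24832, h413 = stmt-HodgeConjecture-24833) until rung 0 closes; count-neutral plumbing (an input of «S-PRIME-DATA★» F0P3a-p05 (g19) and of the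
«XIG-DATA★» glue LH6-p03 (g2): their `hpick`, and the box hypothesis of ★ p849908 `exists_level_hτ_of_smul_cosets`).

THE MATHEMATICS ([Casselman1995, Prop. 1.4.4]: the Iwahori levels `K_n` are compact open and form a neighbourhood basis of `1`; [Rogawski1990, §4.9 p. 54; Prop. 8.1.3 (proof)
p. 116]; [TateThesis1967, §2.3]: principal congruence boxes).  In `X_H := T₂ × U(Φ₁)(L⁺_v)` (`T₂` the diagonal torus of `U(Φ₂)(L⁺_v)`), the level-`nμ` box `W` (torus coordinates
and `γ₂` within `q_{w′}^{−(nμ+1)}` of `1` at every `w′ ∣ v`) is a neighbourhood of `1` (★ `boxXH_mem_nhds_one`), and so is the preimage `V` of the open `G`-level `𝓘.K n` under the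
continuous map `ψ(t, u) := ι_v(t, u)` (★ `continuous_endoEmbLocal`).  `W ∩ V` contains a product `U_A × U_B` of neighbourhoods of `1`; `U_A ⊇ T₂ ∩ K′_{n′}` for some `n′` (★ T-BASIS:
the `U(Φ₂)`-levels restricted to `T₂` shrink to `1`), and `U_B ⊇ V₁` for an open subgroup `V₁` of the NON-ARCHIMEDEAN group `U(Φ₁)(L⁺_v)` (★ `nonarchimedeanGroup_cmLocal`); put
`K₁ := V₁ ∩ U(Φ₁)(𝒪_v)` (★ `isCompact_isOpen_cmLocalIntegralLevel`): open, and compact as a closed (open subgroup!) subset of a compact set.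

* **`exists_level_K₁_box_pick`** — `∃ n′ K₁, IsOpen K₁ ∧ IsCompact K₁ ∧ BOX(nμ) ∧ PICK(𝓘.K n)`, pointwise over `↑k.1 ∈ 𝓘₂.K n′ ∧ k.2 ∈ K₁` (so that ANY packaging of
  `S′ := {k | ↑k.1 ∈ 𝓘₂.K n′ ∧ k.2 ∈ K₁}` as a `Subgroup` — «S-PRIME-DATA★» — reads it by `fun k hk => … (mem_iff.1 hk).1 (mem_iff.1 hk).2`);
* `box_pick_of_subgroup` — the same for every subgroup `S′ ≤ X_H` whose members satisfy `↑k.1 ∈ 𝓘₂.K n′ ∧ k.2 ∈ K₁` (the `∀ k ∈ S′, …` shapes of ★ p849908 and of `hpick`).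

## References
* [Casselman1995] W. Casselman, *Introduction to the theory of admissible representations of `p`-adic reductive groups* (draft 1 May 1995), Prop. 1.4.4 p. 14.
* [Rogawski1990] J. D. Rogawski, *Automorphic Representations of Unitary Groups in Three Variables* (1990), §4.9 p. 54; Prop. 8.1.3 (proof) p. 116; §12.7 L. 12.7.3 (proof) p. 195.
* [TateThesis1967] J. Tate, *Fourier analysis in number fields and Hecke's zeta-functions* (Thesis 1950; Cassels–Fröhlich 1967), §2.3.
* [PlatonovRapinchuk1994] V. Platonov, A. Rapinchuk, *Algebraic Groups and Number Theory* (1994), §3.3 (non-archimedean groups of points).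
-/

set_option autoImplicit false
-- the mandated namespace has the single-problem summit's repeated segment (`HodgeConjecture.HodgeConjecture`)
set_option linter.dupNamespace false

noncomputable section

open Matrix NumberField IsDedekindDomain Filter Topology
open scoped MatrixGroups Pointwise
open Literature.NumberTheory.Rogawski1990 Literature.NumberTheory.Automorphic Literature.NumberTheory.Automorphic.UnitaryGroup
open Literature.NumberTheory.GaloisRepresentations

namespace Summit.HodgeConjecture.HodgeConjecture.Cruxes.H413.F0P3cStCharTSLevelPickInst

variable (L : Type) [Field L] [NumberField L] [IsCMField L] (v : HeightOneSpectrum (𝓞 ↥(maximalRealSubfield L)))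

set_option maxHeartbeats 800000 in  -- statement-level `whnf` on the CM carriers (`cmDatum … .Local v` vs `↥(unitaryGroupOfForm (c ⊗ 1) (cmLocalForm L N v))`)
/-- **«LEVEL-PICK-INST★» — THE HEAD'S CHOICE OF THE `H`-LEVEL.**  For an Iwahori datum `𝓘` of the Borel of `G = U(Φ₃)(L⁺_v)`, a `G`-level `n`, an Iwahori datum `𝓘₂` of the Borel of
`U(Φ₂)(L⁺_v)` (only `hasBasis_K` is used) and a box level `nμ`: there are a level `n′` and a compact open subgroup `K₁ ≤ U(Φ₁)(L⁺_v)` such that every `k = (t, u) ∈ T₂ × U(Φ₁)(L⁺_v)` with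
`↑t ∈ 𝓘₂.K n′` and `u ∈ K₁` satisfies (BOX) the antecedent of ★ `exists_level_hτ_of_smul_cosets` at level `nμ` VERBATIM (torus coordinates `(t)_{ii}` and `γ₂(t, u)` within
`q_{w′}^{−(nμ+1)}` of `1` at every `w′ ∣ v`) and (PICK) `ι_v(t, u) ∈ 𝓘.K n`.  Proof: ★ `boxXH_mem_nhds_one` + continuity of `ι_v` (★ `continuous_endoEmbLocal`) + `𝓘.isOpen_K` give a
neighbourhood `W ∩ V` of `1`; split it as a product (Mathlib `mem_nhds_prod_iff`); shrink the `T₂`-factor to a level by ★ T-BASIS `exists_preimage_K_subset_of_mem_nhds`, the `U(Φ₁)`-factor to an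
open subgroup by ★ `nonarchimedeanGroup_cmLocal`, intersected with the compact open `U(Φ₁)(𝒪_v)` (★ `isCompact_isOpen_cmLocalIntegralLevel`).
[cite: Casselman1995, Prop. 1.4.4 p. 14] [cite: Rogawski1990, §4.9 p. 54; Prop. 8.1.3 (proof) p. 116] [cite: TateThesis1967, §2.3] -/
theorem exists_level_K₁_box_pick (𝓘 : (cmBorelTriple L 3 v).IwahoriDatum) (n : ℕ) (𝓘₂ : (cmBorelTriple L 2 v).IwahoriDatum) (nμ : ℕ) :
    ∃ (n' : ℕ) (K₁ : Subgroup ((cmDatum L 1 (Matrix.of fun i j : Fin 1 => if i.val + j.val + 1 = 1 then (1 : L) else 0)).Local v)),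
      IsOpen (K₁ : Set ((cmDatum L 1 (Matrix.of fun i j : Fin 1 => if i.val + j.val + 1 = 1 then (1 : L) else 0)).Local v)) ∧
      IsCompact (K₁ : Set ((cmDatum L 1 (Matrix.of fun i j : Fin 1 => if i.val + j.val + 1 = 1 then (1 : L) else 0)).Local v)) ∧
      (∀ k : ↥(cmBorelTriple L 2 v).M × (cmDatum L 1 (Matrix.of fun i j : Fin 1 => if i.val + j.val + 1 = 1 then (1 : L) else 0)).Local v,
          (k.1 : ↥(unitaryGroupOfForm (conjLocal L (IsCMField.complexConj L) v) (cmLocalForm L 2 v))) ∈ 𝓘₂.K n' → k.2 ∈ K₁ →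
        (∀ i : Fin 2, ∀ w' : PlacesOver L v,
            Valued.v (((torusEntry (conjLocal L (IsCMField.complexConj L) v) (cmLocalForm L 2 v) i k.1 : (LocalRing L v)ˣ) : LocalRing L v) w' - 1) <
              WithZero.exp (-((nμ + 1 : ℕ) : ℤ))) ∧
          (∀ w' : PlacesOver L v,
            Valued.v (finGammaTwo L v ((k.1 : ↥(unitaryGroupOfForm (conjLocal L (IsCMField.complexConj L) v) (cmLocalForm L 2 v))), k.2) w' - 1) <
              WithZero.exp (-((nμ + 1 : ℕ) : ℤ)))) ∧
      (∀ k : ↥(cmBorelTriple L 2 v).M × (cmDatum L 1 (Matrix.of fun i j : Fin 1 => if i.val + j.val + 1 = 1 then (1 : L) else 0)).Local v,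
          (k.1 : ↥(unitaryGroupOfForm (conjLocal L (IsCMField.complexConj L) v) (cmLocalForm L 2 v))) ∈ 𝓘₂.K n' → k.2 ∈ K₁ →
        endoEmbLocal L v ((k.1 : ↥(unitaryGroupOfForm (conjLocal L (IsCMField.complexConj L) v) (cmLocalForm L 2 v))), k.2) ∈ 𝓘.K n) := by
  haveI : NonarchimedeanGroup ((cmDatum L 1 (Matrix.of fun i j : Fin 1 => if i.val + j.val + 1 = 1 then (1 : L) else 0)).Local v) :=
    nonarchimedeanGroup_cmLocal L 1 v
  -- the two neighbourhoods of `1` in `X_H = T₂ × U(Φ₁)_v`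
  have hW := F0P3cStCharTSHtauOnCoset.boxXH_mem_nhds_one L v nμ
  -- `ψ(t, u) := ι_v(t, u)` as a continuous homomorphism `X_H →* G`
  set ψ : ↥(cmBorelTriple L 2 v).M × (cmDatum L 1 (Matrix.of fun i j : Fin 1 => if i.val + j.val + 1 = 1 then (1 : L) else 0)).Local v →*
      ↥(unitaryGroupOfForm (conjLocal L (IsCMField.complexConj L) v) (cmLocalForm L 3 v)) :=
    (endoEmbLocal L v).comp (((cmBorelTriple L 2 v).M.subtype).prodMap
      (MonoidHom.id ((cmDatum L 1 (Matrix.of fun i j : Fin 1 => if i.val + j.val + 1 = 1 then (1 : L) else 0)).Local v))) with hψdef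
  have hψ : Continuous ψ := (continuous_endoEmbLocal L v).comp (continuous_subtype_val.prodMap continuous_id)
  have hV : (ψ : _ → ↥(unitaryGroupOfForm (conjLocal L (IsCMField.complexConj L) v) (cmLocalForm L 3 v))) ⁻¹'
        ((𝓘.K n : Subgroup ↥(unitaryGroupOfForm (conjLocal L (IsCMField.complexConj L) v) (cmLocalForm L 3 v))) :
          Set ↥(unitaryGroupOfForm (conjLocal L (IsCMField.complexConj L) v) (cmLocalForm L 3 v))) ∈
      𝓝 (1 : ↥(cmBorelTriple L 2 v).M × (cmDatum L 1 (Matrix.of fun i j : Fin 1 => if i.val + j.val + 1 = 1 then (1 : L) else 0)).Local v) := by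
    refine ((𝓘.isOpen_K n).preimage hψ).mem_nhds ?_
    rw [Set.mem_preimage, SetLike.mem_coe, map_one]
    exact (𝓘.K n).one_mem
  -- split the intersection as a product of neighbourhoods
  obtain ⟨UA, hUA, UB, hUB, hsub⟩ := mem_nhds_prod_iff.1 (Filter.inter_mem hW hV)
  -- the `T₂`-factor: a level of `𝓘₂`
  obtain ⟨n', hn'⟩ := F0P3cStCharTSTorusLevelBasis.exists_preimage_K_subset_of_mem_nhds (cmBorelTriple L 2 v) 𝓘₂ (cmBorelTriple L 2 v).M hUA
  -- the `U(Φ₁)`-factor: an open subgroup, cut down to the compact open `U(Φ₁)(𝒪_v)`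
  obtain ⟨V₁, hV₁⟩ := NonarchimedeanGroup.is_nonarchimedean UB hUB
  have hKv := isCompact_isOpen_cmLocalIntegralLevel L 1 (Matrix.of fun i j : Fin 1 => if i.val + j.val + 1 = 1 then (1 : L) else 0) v
  refine ⟨n', V₁.toSubgroup ⊓ cmLocalIntegralLevel L 1 (Matrix.of fun i j : Fin 1 => if i.val + j.val + 1 = 1 then (1 : L) else 0) v, ?_, ?_, ?_, ?_⟩
  · -- open
    rw [Subgroup.coe_inf]
    exact V₁.isOpen.inter hKv.2
  · -- compact: a closed (open subgroup) subset of the compact `U(Φ₁)(𝒪_v)`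
    have hopen : IsOpen ((V₁.toSubgroup ⊓ cmLocalIntegralLevel L 1 (Matrix.of fun i j : Fin 1 => if i.val + j.val + 1 = 1 then (1 : L) else 0) v :
        Subgroup ((cmDatum L 1 (Matrix.of fun i j : Fin 1 => if i.val + j.val + 1 = 1 then (1 : L) else 0)).Local v)) :
        Set ((cmDatum L 1 (Matrix.of fun i j : Fin 1 => if i.val + j.val + 1 = 1 then (1 : L) else 0)).Local v)) := by
      rw [Subgroup.coe_inf]
      exact V₁.isOpen.inter hKv.2
    refine hKv.1.of_isClosed_subset (Subgroup.isClosed_of_isOpen _ hopen) ?_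
    rw [Subgroup.coe_inf]
    exact Set.inter_subset_right
  · -- BOX
    intro k hk1 hk2
    have hk : k ∈ UA ×ˢ UB := Set.mk_mem_prod (hn' hk1) (hV₁ (Subgroup.mem_inf.1 hk2).1)
    exact (hsub hk).1
  · -- PICK
    intro k hk1 hk2
    have hk : k ∈ UA ×ˢ UB := Set.mk_mem_prod (hn' hk1) (hV₁ (Subgroup.mem_inf.1 hk2).1)
    exact (hsub hk).2

/-- **«LEVEL-PICK-INST★» in the `∀ k ∈ S′` shapes** of ★ `exists_level_hτ_of_smul_cosets` (BOX) and of «S-PRIME-DATA★»'s `hpick` (PICK): for every subgroup `S′ ≤ T₂ × U(Φ₁)_v`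
whose members have `↑k.1 ∈ 𝓘₂.K n′` and `k.2 ∈ K₁` (e.g. THE `S′` cut out by these two conditions). [cite: Casselman1995, Prop. 1.4.4 p. 14] [cite: Rogawski1990, §4.9 p. 54] -/
theorem exists_level_K₁_box_pick_subgroup (𝓘 : (cmBorelTriple L 3 v).IwahoriDatum) (n : ℕ) (𝓘₂ : (cmBorelTriple L 2 v).IwahoriDatum) (nμ : ℕ) :
    ∃ (n' : ℕ) (K₁ : Subgroup ((cmDatum L 1 (Matrix.of fun i j : Fin 1 => if i.val + j.val + 1 = 1 then (1 : L) else 0)).Local v)),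
      IsOpen (K₁ : Set ((cmDatum L 1 (Matrix.of fun i j : Fin 1 => if i.val + j.val + 1 = 1 then (1 : L) else 0)).Local v)) ∧
      IsCompact (K₁ : Set ((cmDatum L 1 (Matrix.of fun i j : Fin 1 => if i.val + j.val + 1 = 1 then (1 : L) else 0)).Local v)) ∧
      ∀ S' : Subgroup (↥(cmBorelTriple L 2 v).M × (cmDatum L 1 (Matrix.of fun i j : Fin 1 => if i.val + j.val + 1 = 1 then (1 : L) else 0)).Local v),
        (∀ k ∈ S', (k.1 : ↥(unitaryGroupOfForm (conjLocal L (IsCMField.complexConj L) v) (cmLocalForm L 2 v))) ∈ 𝓘₂.K n' ∧ k.2 ∈ K₁) →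
        (∀ k ∈ S', (∀ i : Fin 2, ∀ w' : PlacesOver L v,
            Valued.v (((torusEntry (conjLocal L (IsCMField.complexConj L) v) (cmLocalForm L 2 v) i k.1 : (LocalRing L v)ˣ) : LocalRing L v) w' - 1) <
              WithZero.exp (-((nμ + 1 : ℕ) : ℤ))) ∧
          (∀ w' : PlacesOver L v,
            Valued.v (finGammaTwo L v ((k.1 : ↥(unitaryGroupOfForm (conjLocal L (IsCMField.complexConj L) v) (cmLocalForm L 2 v))), k.2) w' - 1) <
              WithZero.exp (-((nμ + 1 : ℕ) : ℤ)))) ∧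
        (∀ k ∈ S', endoEmbLocal L v ((k.1 : ↥(unitaryGroupOfForm (conjLocal L (IsCMField.complexConj L) v) (cmLocalForm L 2 v))), k.2) ∈ 𝓘.K n) := by
  obtain ⟨n', K₁, ho, hc, hbox, hpick⟩ := exists_level_K₁_box_pick L v 𝓘 n 𝓘₂ nμ
  exact ⟨n', K₁, ho, hc, fun S' hS' => ⟨fun k hk => hbox k (hS' k hk).1 (hS' k hk).2, fun k hk => hpick k (hS' k hk).1 (hS' k hk).2⟩⟩

end Summit.HodgeConjecture.HodgeConjecture.Cruxes.H413.F0P3cStCharTSLevelPickInst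

end
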